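import Literature.AlgebraicGeometry.Resolution.ControlledTransformBaseChange
import Literature.AlgebraicGeometry.Resolution.HypersurfaceTransform
import Literature.AlgebraicGeometry.Resolution.MarkedIdealsHomogenized
import Literature.AlgebraicGeometry.Resolution.StalkIdealLemmas
import Literature.AlgebraicGeometry.Resolution.CoefficientIdealRestriction
import Literature.AlgebraicGeometry.Resolution.BlowupChartMembership
import Literature.AlgebraicGeometry.Resolution.CanonicalResolutionSmoothCentre
import HarnessLib

/-!
# Strict transforms under non-flat base change: the criterion by prime stalks

Topic: `Literature/AlgebraicGeometry/Resolution`. The boundary half of "the transform of a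
marked ideal commutes with specialization to a fibre" in the spreading-out argument for
`SpreadsShapedFromGenericPoint` (`CanonicalResolutionSpread.lean`; BGMW 2011, Def. 3.1.3 (4):
`E_i = σ_iᶜ(E_{i-1}) ∪ {D_i}`, the strict transforms of the old divisors). For a commutative
square `s ≫ π = π' ≫ t` (the blow-up `π` of a model `Y` along `C`, its fibre `π'` along `t^*C`,
and the inclusions `t`, `s` of the fibres — NOT flat) and a divisor `K` on `Y`, the strict
transform `σᶜ(K) = ⋃ₙ (π^*K : 𝓘(D)ⁿ)` always satisfies `s^* σᶜ(K) ⊆ σ'ᶜ(t^*K)`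
(`comap_strictTransformIdeal_le`); this file PROVES the reverse inclusion from two properties
of the specialized strict transform `𝔰 = s^* σᶜ(K)` which DO descend from the model (smoothness
of `V(σᶜ(K))` over the base and the relative Cartier property of the exceptional divisor on it,
`BlowupsRelativeCartier.lean`):

* `strictTransformIdeal_le_of_prime_stalks` — if an ideal sheaf `𝔰 ⊇ π'^*K'` has PRIME stalks
  at the points of `V(𝔰)` and the exceptional ideal `π'^*C'` is contained in `𝔰` at none of
  them, then `σ'ᶜ(K') ⊆ 𝔰`: for `x` with `𝓘(D')ⁿ x ⊆ π'^*K' ⊆ 𝔰_z`, a local equation `p` of `D'`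
  outside the prime `𝔰_z` gives `pⁿ x ∈ 𝔰_z`, so `x ∈ 𝔰_z` (a one-line replacement for the
  unique-factorization description of strict transforms of divisors);
* `comap_strictTransformIdeal_of_prime_stalks` — **`s^* σᶜ(K) = σ'ᶜ(t^*K)`** under these
  hypotheses on `𝔰 = s^* σᶜ(K)`;
* `isPrime_stalkIdeal_of_isRegular_subscheme` (a regular closed subscheme has prime stalk
  ideals), `not_stalkIdeal_le_of_isEffectiveCartier_comap_subschemeι` (if `P` restricts to an
  effective Cartier divisor on `V(I)` then `P_x ⊄ I_x` on `V(I)`) — the two hypotheses in the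
  form delivered by the fibres of a smooth family and of a relative effective Cartier divisor;
* `MarkedIdeal.transform_comap_of_prime_stalks` — **the transform of the pulled-back marked
  ideal `t^*(Y, 𝓘, E, μ)` under `π'` is the pull-back of the transform** (BGMW Def. 3.1.3
  (3)–(5) in families): ideal part by `comap_controlledTransform_of_isEffectiveCartier`
  (`ControlledTransformBaseChange.lean`: `π^*𝓘 ⊆ 𝓘(D)^μ` and `s^*𝓘(D)` effective Cartier),
  boundary part by the above, member by member.

## Sources

* E. Bierstone, D. Grigoriev, P. Milman, J. Włodarczyk, arXiv:1206.3090, Def. 3.1.3 (3)–(5),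
  §3.2. [BierstoneGrigorievMilmanWlodarczyk2011]
* U. Görtz, T. Wedhorn, *Algebraic Geometry I*, 2nd ed. (2020), (13.19) (strict transform as
  the schematic closure `⋃ₙ (π^*K : 𝓘(D)ⁿ)`). [GortzWedhorn2020]
-/

noncomputable section

open CategoryTheory AlgebraicGeometry TopologicalSpace IsLocalRing

namespace Literature.AlgebraicGeometry.Resolution

universe u

open Scheme.IdealSheafData

/-! ## The free inclusion `s^* σᶜ(K) ⊆ σ'ᶜ(t^* K)` -/

section Free

variable {Y' Y Z' Z : Scheme.{u}} (t : Y' ⟶ Y) {π : Z ⟶ Y} {π' : Z' ⟶ Y'} {s : Z' ⟶ Z}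

/-- The colon ideal sheaf is antitone in its second argument. [folklore] -/
theorem colon_antitone_right {X : Scheme.{u}} (L : X.IdealSheafData) {M M' : X.IdealSheafData}
    (h : M ≤ M') : colon L M' ≤ colon L M :=
  le_colon_iff.mpr ((mul_le_mul' h le_rfl).trans (mul_colon_le L M'))

/-- **Pull-backs of colon ideal sheaves**: `f^*(L : M) ⊆ (f^*L : f^*M)` for any morphism `f`.
[folklore] -/
theorem comap_colon_le {X' X : Scheme.{u}} (f : X' ⟶ X) (L M : X.IdealSheafData) :
    (colon L M).comap f ≤ colon (L.comap f) (M.comap f) := by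
  rw [le_colon_iff, ← comap_mul]
  exact comap_mono _ (mul_colon_le L M)

/-- `π^*K ⊆ σᶜ(K)` (the term `n = 0`). [folklore] -/
theorem comap_le_strictTransformIdeal (π : Z ⟶ Y) (C K : Y.IdealSheafData) :
    K.comap π ≤ strictTransformIdeal π C K :=
  le_iSup_of_le (f := fun n : ℕ => colon (K.comap π) ((C.comap π) ^ n)) 0
    (by rw [pow_zero, one_eq_top, colon_top])

/-- **`s^* σᶜ(K) ⊆ σ'ᶜ(t^*K)`** for every commutative square `s ≫ π = π' ≫ t` (pull-back of a
colon is inside the colon of the pull-backs, term by term). [folklore] -/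
theorem comap_strictTransformIdeal_le (hsq : s ≫ π = π' ≫ t) (C K : Y.IdealSheafData) :
    (strictTransformIdeal π C K).comap s ≤ strictTransformIdeal π' (C.comap t) (K.comap t) := by
  rw [strictTransformIdeal, strictTransformIdeal, (map_gc s).l_iSup]
  refine iSup_mono fun n => (comap_colon_le s _ _).trans (le_of_eq ?_)
  rw [comap_pow, ← comap_comp, ← comap_comp, hsq, comap_comp, comap_comp]

end Free

/-! ## The reverse inclusion from prime stalks -/

section Prime

variable {Y' Z' : Scheme.{u}} [IsLocallyNoetherian Z'] {π' : Z' ⟶ Y'}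

/-- **The strict transform lies in every ideal sheaf `𝔰 ⊇ π'^*K'` with prime stalks not
containing the exceptional ideal**: if `𝔰_z` is prime and `(π'^*C')_z ⊄ 𝔰_z` at every
`z ∈ V(𝔰)`, then `σ'ᶜ(K') = ⋃ₙ (π'^*K' : (π'^*C')ⁿ) ⊆ 𝔰`. [folklore] -/
theorem strictTransformIdeal_le_of_prime_stalks (C' K' : Y'.IdealSheafData)
    (𝔰 : Z'.IdealSheafData) (hle : K'.comap π' ≤ 𝔰)
    (hprime : ∀ z ∈ 𝔰.support, (stalkIdeal 𝔰 z).IsPrime)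
    (hE : ∀ z ∈ 𝔰.support, ¬ stalkIdeal (C'.comap π') z ≤ stalkIdeal 𝔰 z) :
    strictTransformIdeal π' C' K' ≤ 𝔰 := by
  refine le_of_forall_stalkIdeal_le fun z => ?_
  by_cases hz : z ∈ 𝔰.support
  · haveI := hprime z hz
    obtain ⟨p, hp, hp𝔰⟩ := Set.not_subset.mp (hE z hz)
    intro x hx
    rw [strictTransformIdeal, stalkIdeal_iSup] at hx
    refine Submodule.iSup_induction (motive := fun x => x ∈ stalkIdeal 𝔰 z) _ hx ?_ (zero_mem _)
      (fun x y hx hy => add_mem hx hy)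
    intro n x hx
    rw [stalkIdeal_colon, stalkIdeal_pow] at hx
    have hpn : p ^ n ∈ ((stalkIdeal (C'.comap π') z ^ n : Ideal _) : Set (Z'.presheaf.stalk z)) :=
      Ideal.pow_mem_pow hp n
    have hxp : x * p ^ n ∈ stalkIdeal 𝔰 z := by
      have h := Submodule.mem_colon.mp hx (p ^ n) hpn
      rw [smul_eq_mul] at h
      exact stalkIdeal_mono hle z h
    rcases (hprime z hz).mem_or_mem hxp with h | h
    · exact h
    · exact absurd ((hprime z hz).mem_of_pow_mem n h) hp𝔰
  · rw [stalkIdeal_eq_top_of_not_mem_support hz]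
    exact le_top

variable {Y Z : Scheme.{u}} (t : Y' ⟶ Y) {π : Z ⟶ Y} {s : Z' ⟶ Z}

/-- **Strict transforms commute with the base change to a fibre, given prime stalks**: for a
commutative square `s ≫ π = π' ≫ t`, if `𝔰 := s^* σᶜ(K)` has prime stalks at the points of
`V(𝔰)` and the pulled-back exceptional ideal `s^* π^* C` is contained in `𝔰` at none of them,
then `s^* σᶜ(K) = σ'ᶜ(t^*K)`. [cite: BierstoneGrigorievMilmanWlodarczyk2011, Def. 3.1.3 (4); GortzWedhorn2020, (13.19)] -/
theorem comap_strictTransformIdeal_of_prime_stalks (hsq : s ≫ π = π' ≫ t) (C K : Y.IdealSheafData)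
    (hprime : ∀ z ∈ ((strictTransformIdeal π C K).comap s).support,
      (stalkIdeal ((strictTransformIdeal π C K).comap s) z).IsPrime)
    (hE : ∀ z ∈ ((strictTransformIdeal π C K).comap s).support,
      ¬ stalkIdeal ((C.comap π).comap s) z ≤ stalkIdeal ((strictTransformIdeal π C K).comap s) z) :
    (strictTransformIdeal π C K).comap s = strictTransformIdeal π' (C.comap t) (K.comap t) := by
  refine le_antisymm (comap_strictTransformIdeal_le t hsq C K)
    (strictTransformIdeal_le_of_prime_stalks _ _ _ ?_ hprime fun z hz => ?_)
  · rw [← comap_comp, ← hsq, comap_comp]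
    exact comap_mono _ (comap_le_strictTransformIdeal π C K)
  · rw [← comap_comp, ← hsq, comap_comp]
    exact hE z hz

end Prime

/-! ## The two hypotheses, from regular subschemes and relative Cartier divisors -/

section Hypotheses

variable {X : Scheme.{u}}

/-- **A regular closed subscheme has prime stalk ideals** (`𝒪_{X,x}/I_x ≅ 𝒪_{V(I),x}` is a
regular local ring, hence a domain). [cite: Matsumura1987, Thm. 14.3] -/
theorem isPrime_stalkIdeal_of_isRegular_subscheme [IsLocallyNoetherian X] {I : X.IdealSheafData}
    (h : Scheme.IsRegular I.subscheme) {x : X} (hx : x ∈ I.support) : (stalkIdeal I x).IsPrime := by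
  haveI := isRegularLocalRing_stalk_quotient_stalkIdeal h hx
  haveI := isDomain_of_isRegularLocalRing (X.presheaf.stalk x ⧸ stalkIdeal I x)
  exact (Ideal.Quotient.isDomain_iff_prime _).mp inferInstance

/-- **If `P` restricts to an effective Cartier divisor on `V(I)` then `P_x ⊄ I_x` at every point
of `V(I)`** (the stalk of `P · 𝒪_{V(I)}` is generated by a non-zero-divisor of the non-zero local
ring `𝒪_{V(I),x} = 𝒪_{X,x}/I_x`, so it is not zero). [folklore] -/
theorem not_stalkIdeal_le_of_isEffectiveCartier_comap_subschemeι {I P : X.IdealSheafData}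
    (h : IsEffectiveCartier (P.comap I.subschemeι)) {x : X} (hx : x ∈ I.support) :
    ¬ stalkIdeal P x ≤ stalkIdeal I x := by
  intro hle
  obtain ⟨z, rfl⟩ : x ∈ Set.range I.subschemeι := by
    rw [range_subschemeι]
    exact hx
  obtain ⟨g, hg, hgen⟩ := h.exists_stalkIdeal_eq_span z
  have h0 : stalkIdeal (P.comap I.subschemeι) z = ⊥ := by
    rw [stalkIdeal_comap_eq_map_stalkMap, ← le_bot_iff, Ideal.map_le_iff_le_comap]
    intro a ha
    rw [Ideal.mem_comap, Ideal.mem_bot, ← RingHom.mem_ker, ker_stalkMap_subschemeι]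
    exact hle ha
  rw [h0, eq_comm, Ideal.span_singleton_eq_bot] at hgen
  exact nonZeroDivisors.ne_zero hg hgen

end Hypotheses

/-! ## The transform of a marked ideal under the base change to a fibre -/

section Transform

variable {Y' Y Z' Z : Scheme.{u}} (t : Y' ⟶ Y) {π : Z ⟶ Y} {π' : Z' ⟶ Y'} {s : Z' ⟶ Z}

/-- **The transform of a marked ideal commutes with the base change to a fibre** (BGMW
Def. 3.1.3 (3)–(5) in families; the non-flat companion of `MarkedIdeal.transform_comap_of_flat`).
For a commutative square `s ≫ π = π' ≫ t` suppose: `𝓘(D) = π^*C` is an effective Cartier divisor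
with `π^*𝓘 ⊆ 𝓘(D)^μ` and `s^*𝓘(D)` is an effective Cartier divisor (ideal part,
`comap_controlledTransform_of_isEffectiveCartier`); and for every boundary divisor `K` of `M` the
specialized strict transform `s^* σᶜ(K)` has prime stalks not containing `s^*𝓘(D)` on its
support (boundary part, `comap_strictTransformIdeal_of_prime_stalks`). Then
`(t^*M).transform π' (t^*C) = s^*(M.transform π C)`.
[cite: BierstoneGrigorievMilmanWlodarczyk2011, Def. 3.1.3 (3)–(5)] -/
theorem MarkedIdeal.transform_comap_of_prime_stalks [IsLocallyNoetherian Z] [IsLocallyNoetherian Z']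
    (hsq : s ≫ π = π' ≫ t) (M : MarkedIdeal Y) (C : Y.IdealSheafData)
    (hD : IsEffectiveCartier (C.comap π)) (hle : M.ideal.comap π ≤ C.comap π ^ M.mult)
    (hDs : IsEffectiveCartier ((C.comap π).comap s))
    (hE : ∀ K ∈ M.boundary, ∀ z ∈ ((strictTransformIdeal π C K).comap s).support,
      (stalkIdeal ((strictTransformIdeal π C K).comap s) z).IsPrime ∧
        ¬ stalkIdeal ((C.comap π).comap s) z ≤ stalkIdeal ((strictTransformIdeal π C K).comap s) z) :
    (M.comap t).transform π' (C.comap t) = (M.transform π C).comap s := by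
  change (⟨M.ideal.comap t, M.boundary.map (·.comap t), M.mult⟩ : MarkedIdeal Y').transform π'
      (C.comap t) =
    ⟨(M.transform π C).ideal.comap s, (M.transform π C).boundary.map (·.comap s), M.mult⟩
  simp only [MarkedIdeal.transform, List.map_append, List.map_map, List.map_cons, List.map_nil,
    comap_controlledTransform_of_isEffectiveCartier t hsq C M.ideal M.mult hD hle hDs]
  congr 2
  · refine List.map_congr_left fun K hK => ?_
    simp only [Function.comp_apply]
    exact (comap_strictTransformIdeal_of_prime_stalks t hsq C K (fun z hz => (hE K hK z hz).1)
      (fun z hz => (hE K hK z hz).2)).symm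
  · rw [← Scheme.IdealSheafData.comap_comp, ← Scheme.IdealSheafData.comap_comp, hsq]

end Transform

end Literature.AlgebraicGeometry.Resolution

end
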